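/-
Copyright: the b2b-balaban T⁴-continuum CRUX team, row NE7b OWNER lineage `t4-ne7b-p1` (gen 139). Project licence.
-/
import Summits.QuantumFields.BalabanUV.T4Continuum.Spine.NE7b.SupDobrushinCovarianceGibbs
import Summits.QuantumFields.BalabanUV.T4Continuum.Spine.NE7b.SupDobrushinNeumannMatrix

/-!
# THE COVARIANCE KERNEL LETTER OF A TILTED GAUSSIAN ON `ℝ^ι` (SCOPING (d10)(2) — THE ROAD'S SHAPE): for the potential
#   `V(z) = ½ z·Mz + U(toLp z + ψ)`   (`M` symmetric — the precision of the Gaussian reference; `U ∈ C¹` with derivative `U′`)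
# with FIRST-ORDER KERNEL LETTERS of the input along coordinate directions `e_x = EuclideanSpace.single x 1`,
#   diagonal floor `−lam·r² ≤ (U′(φ+re_x) − U′(φ))(e_x)·r`, diagonal ceiling `|(U′(φ+re_x) − U′(φ))(e_x)| ≤ κd|r|`,
#   cross letters `|(U′(φ+re_z) − U′(φ))(e_x)| ≤ H_{xz}|r|`,
# and ROW-DIAGONAL DOMINANCE OF THE PRECISION over the input's Hessian kernel, `Σ_{z≠x}(|M_{xz}| + H_{xz}) ≤ γ(M_{xx} − lam)` (`γ < 1`; columns
# `≤ γ′ < 1`), the gradient components `F_x(z) = U′(toLp z + ψ)(e_x)` have, under the Gibbs law `ν_ψ ∝ e^{−V}dz`, the covariance kernel letter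
#   `Σ_y |Cov_{ν_ψ}(F_x, F_y)| ≤ κR·κC·(1−γ)⁻¹(1−γ′)⁻¹ ∕ cmin`
# (`κR, κC` the row∕column letters of the first-order kernel majorant `Hd` (`= κd` on the diagonal, `H` off it), `cmin ≤ M_{xx} − lam`) —
# UNIFORMLY IN THE BACKGROUND `ψ` AND IN THE VOLUME `|ι|`.  This is the quantity (439) `hessian_kernel_rowsum_split` left open, in the
# Lebesgue∕precision dress `e^{−½z·Mz − U(z+ψ)}dz` of the road's `e^{−U(ω+ψ)}dN(0,Γ)(ω)`, `M = Γ⁻¹` ((421) `integral_gaussWeight_mul`)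
# (row NE7b, node U5c; (447), (448) BY NAME; [folklore] — Dobrushin 1970, Föllmer 1982)

Cell `pub-balaban`, sub-cell `t4`, spine estimate NE7b (`T4WeightBudget.RelWeightBound`; the cell's OWN estimate — NOT PRINTED in
[Bałaban 1983–89], NOT PROVED).  Crux-route work under `Spine/NE7b/` by the row OWNER (`t4-ne7b-p1` gen 139, file (449)) under FREEZE
(0)'s crux-prover clause; NOTHING of Bałaban's is named as a Lean object, valued or asserted; no `T4Continuum/Support` leaf typed; no
`def`, no notation (`V`, `V₁`, `F_x`, `J`, `c`, `D` WRITTEN OUT; the sampler `P` hypothesis-characterised); zero `sorry`.  Imports (BY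
NAME): the OWNER's (447) `…SupDobrushinCovarianceGibbs` (`cov_rowsum_le_gibbs`), (448) `…SupDobrushinNeumannMatrix` (`neumann_nonneg`,
`neumann_dominates`, `neumann_rowsum_le`, `neumann_colsum_le`).

WHAT IS PROVED ([folklore]; `M : Matrix ι ι ℝ` symmetric, `U, U′` with `HasFDerivAt U (U′ φ) φ`, background `ψ`):
* §1 coordinate lines in `ℝ^ι`: `update_eq_add_single`, `toLp_update` (`toLp(z^{x,s}) + ψ = (toLp(z^{x,t}) + ψ) + (s−t)•e_x`), `mulVec_update_apply`
  (`(Mz^{x,s})_w − (Mz^{x,t})_w = M_{wx}(s−t)`), `quad_update` (the quadratic form along the line).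
* §2 the structural hypotheses of (447) for `V`: `tilted_line_hasDerivAt` (`∂_xV = (Mz)_x + U′(toLp z+ψ)(e_x)`), `tilted_floor` (`c_x = M_{xx} − lam`),
  `tilted_ceiling` (`Cw = mM + κd`), `tilted_cross` (`J_{xz} = |M_{xz}| + H_{xz}`), `tilted_continuous`, `gradient_obs_lipVec`
  (`F_x` has vector `Hd_x = (κd at x, H_{x·} off x)`).
* §3 THE END **`tilted_cov_kernel_rowsum_le`**: `Σ_y |∫F_xF_y dν − ∫F_x dν∫F_y dν| ≤ κR·κC·(1−γ)⁻¹·(1−γ′)⁻¹∕cmin`, `D` = the Neumann matrix of (448).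
* §4 toy: none (all hypotheses are letters; (450) instantiates them from (427)'s class and transfers to (439)'s `N(0,Γ)` format).

HONEST (what this is NOT).  The letters are FIRST-ORDER hypotheses on `U′` along coordinate directions and on the precision `M` (row-diagonal
dominance with margin over the input's kernel) — the road must supply them: for (427)'s output class the Hessian kernel letters (433)∕(438)
give `H`, `κd`, `lam`; the dominance of `Γ⁻¹` is a CONDITION ON THE NEXT COVARIANCE in kernel (ℓ^∞) letters, the analogue of the form floor
`m − λ > 0` used for Brascamp–Lieb.  The moment letters `e^{−V}, z_w²e^{−V} ∈ L¹` are inputs (the road's regulator (410)).  The transfer to the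
`dN(0,Γ)` format of (439) and the re-run of (427) in kernel letters ((d10)(3)) are the successor's.  Scalar skeleton ((A3), NC-NE7b-α UNRULED);
nothing of Bałaban's asserted.  BY-NAME EFFECT ON THE WALL: NONE.  NE7b NOT PRINTED ∕ NOT PROVED; spine PROVED 0∕9; rung (B)+1 — the
programme's measures remain FINITE-torus statements; NOT the mass gap, NOT Clay.  HONEST DEPENDENCY: continuum YM on T⁴ ⇐ BetaPertH ∧ nine
spine estimates (0∕9 proved); BetaPertH ⇐ (D1) ∧ (D4) ∧ CAP+tail; G-an2-4 gates asym, D1 and NE2∕3∕4.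
-/

set_option autoImplicit false

noncomputable section

namespace Summit.QuantumFields.BalabanUV.T4Continuum.NE7b.SupTiltedCovarianceKernelLetter

open MeasureTheory Real Set Function Finset Matrix
open scoped BigOperators
open SupDobrushinCovarianceGibbs (cov_rowsum_le_gibbs)
open SupDobrushinNeumannMatrix (neumann_nonneg neumann_dominates neumann_rowsum_le neumann_colsum_le)

variable {ι : Type} [Fintype ι] [DecidableEq ι]

variable {M : Matrix ι ι ℝ} {U : EuclideanSpace ℝ ι → ℝ} {U' : EuclideanSpace ℝ ι → EuclideanSpace ℝ ι →L[ℝ] ℝ}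
  {ψ : EuclideanSpace ℝ ι} {lam κd mM γ γ' cmin κR κC : ℝ} {H : ι → ι → ℝ}
  {P : ι → ((ι → ℝ) → ℝ) → ((ι → ℝ) → ℝ)}

/-! ## §1. Coordinate lines in `ℝ^ι` -/

omit [Fintype ι] in
/-- `z^{x,s} = z + (s − z_x)•δ_x`. [folklore] -/
theorem update_eq_add_single (z : ι → ℝ) (x : ι) (s : ℝ) : update z x s = z + (s - z x) • Pi.single x (1 : ℝ) := by
  funext w
  by_cases h : w = x
  · subst h; simp
  · simp [h]

omit [Fintype ι] in
/-- **The line in `EuclideanSpace`**: `toLp(z^{x,s}) + ψ = (toLp(z^{x,t}) + ψ) + (s − t)•e_x`. [folklore] -/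
theorem toLp_update (z : ι → ℝ) (x : ι) (s t : ℝ) (ψ : EuclideanSpace ℝ ι) :
    WithLp.toLp 2 (update z x s) + ψ = (WithLp.toLp 2 (update z x t) + ψ) + (s - t) • EuclideanSpace.single x (1 : ℝ) := by
  have he : EuclideanSpace.single x (1 : ℝ) = WithLp.toLp 2 (Pi.single x (1 : ℝ)) := rfl
  rw [update_eq_add_single z x s, update_eq_add_single z x t, WithLp.toLp_add, WithLp.toLp_add, WithLp.toLp_smul, WithLp.toLp_smul, ← he]
  module

/-- **The precision along the line**: `(Mz^{x,s})_w − (Mz^{x,t})_w = M_{wx}(s − t)`. [folklore] -/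
theorem mulVec_update_apply (M : Matrix ι ι ℝ) (z : ι → ℝ) (x w : ι) (s t : ℝ) :
    (M *ᵥ update z x s) w - (M *ᵥ update z x t) w = M w x * (s - t) := by
  rw [update_eq_add_single z x s, update_eq_add_single z x t, mulVec_add, mulVec_add, mulVec_smul, mulVec_smul, mulVec_single_one]
  simp only [Pi.add_apply, Pi.smul_apply, smul_eq_mul, Matrix.col_apply]
  ring

/-- **The quadratic form along the line** (`M` symmetric):
`z^{x,s}·Mz^{x,s} = z·Mz + 2(s − z_x)(Mz)_x + (s − z_x)²M_{xx}`. [folklore] -/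
theorem quad_update (hMsym : M.IsSymm) (z : ι → ℝ) (x : ι) (s : ℝ) :
    update z x s ⬝ᵥ (M *ᵥ update z x s) = z ⬝ᵥ (M *ᵥ z) + 2 * (s - z x) * (M *ᵥ z) x + (s - z x) ^ 2 * M x x := by
  have hcross : z ⬝ᵥ (M *ᵥ Pi.single x (1 : ℝ)) = (M *ᵥ z) x := by
    rw [dotProduct_mulVec, ← mulVec_transpose, hMsym.eq, dotProduct_single, mul_one]
  rw [update_eq_add_single z x s]
  set t := s - z x with ht
  rw [mulVec_add, mulVec_smul, add_dotProduct, dotProduct_add, dotProduct_add, smul_dotProduct, smul_dotProduct, dotProduct_smul,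
    dotProduct_smul, hcross, single_dotProduct, single_dotProduct, mulVec_single_one]
  simp only [smul_eq_mul, Matrix.col_apply, one_mul]
  ring

/-! ## §2. The structural hypotheses of (447) for `V(z) = ½z·Mz + U(toLp z + ψ)` -/

/-- **The partial derivatives of `V` along coordinate lines**: `s ↦ V(z^{x,s})` has derivative `(Mz)_x + U′(toLp z + ψ)(e_x)` at `s = z_x`.
[folklore] -/
theorem tilted_line_hasDerivAt (hMsym : M.IsSymm) (hUd : ∀ φ, HasFDerivAt U (U' φ) φ) (ψ : EuclideanSpace ℝ ι) (x : ι) (z : ι → ℝ) :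
    HasDerivAt (fun s => 1 / 2 * (update z x s ⬝ᵥ (M *ᵥ update z x s)) + U (WithLp.toLp 2 (update z x s) + ψ))
      ((M *ᵥ z) x + U' (WithLp.toLp 2 z + ψ) (EuclideanSpace.single x (1 : ℝ))) (z x) := by
  -- the quadratic part, as a polynomial in `s`
  have hq : HasDerivAt (fun s => 1 / 2 * (update z x s ⬝ᵥ (M *ᵥ update z x s))) ((M *ᵥ z) x) (z x) := by
    have e : (fun s => 1 / 2 * (update z x s ⬝ᵥ (M *ᵥ update z x s))) =
        fun s => 1 / 2 * (z ⬝ᵥ (M *ᵥ z) + 2 * (s - z x) * (M *ᵥ z) x + (s - z x) * (s - z x) * M x x) := by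
      funext s; rw [quad_update hMsym]; ring
    rw [e]
    have h1 : HasDerivAt (fun s => s - z x) 1 (z x) := (hasDerivAt_id (z x)).sub_const (z x)
    have h2 : HasDerivAt (fun s => (s - z x) * (s - z x)) (1 * (z x - z x) + (z x - z x) * 1) (z x) := h1.fun_mul h1
    have h := ((((h1.const_mul (2 : ℝ)).mul_const ((M *ᵥ z) x)).const_add (z ⬝ᵥ (M *ᵥ z))).fun_add (h2.mul_const (M x x))).const_mul
      (1 / 2 : ℝ)
    exact h.congr_deriv (by ring)
  -- the potential part, by the chain rule along the affine line
  have hl : HasDerivAt (fun s => WithLp.toLp 2 (update z x s) + ψ) (EuclideanSpace.single x (1 : ℝ)) (z x) := by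
    have e : (fun s => WithLp.toLp 2 (update z x s) + ψ) =
        fun s => (WithLp.toLp 2 (update z x (z x)) + ψ) + (s - z x) • EuclideanSpace.single x (1 : ℝ) := by
      funext s; rw [toLp_update z x s (z x) ψ]
    rw [e]
    have h := (((hasDerivAt_id (z x)).sub_const (z x)).smul_const (EuclideanSpace.single x (1 : ℝ))).const_add
      (WithLp.toLp 2 (update z x (z x)) + ψ)
    simpa using h
  have hU : HasDerivAt (fun s => U (WithLp.toLp 2 (update z x s) + ψ)) (U' (WithLp.toLp 2 z + ψ) (EuclideanSpace.single x (1 : ℝ))) (z x) := by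
    have h := (hUd (WithLp.toLp 2 (update z x (z x)) + ψ)).comp_hasDerivAt (z x) hl
    simp only [update_eq_self] at h
    exact h
  exact hq.fun_add hU

/-- **The diagonal floor** `c_x = M_{xx} − lam`. [folklore] -/
theorem tilted_floor (hUfloor : ∀ (x : ι) (φ : EuclideanSpace ℝ ι) (r : ℝ),
      -lam * r ^ 2 ≤ (U' (φ + r • EuclideanSpace.single x (1 : ℝ)) (EuclideanSpace.single x (1 : ℝ)) - U' φ (EuclideanSpace.single x (1 : ℝ))) * r)
    (ψ : EuclideanSpace ℝ ι) (x : ι) (z : ι → ℝ) (s t : ℝ) :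
    (M x x - lam) * (s - t) ^ 2 ≤
      (((M *ᵥ update z x s) x + U' (WithLp.toLp 2 (update z x s) + ψ) (EuclideanSpace.single x (1 : ℝ))) -
        ((M *ᵥ update z x t) x + U' (WithLp.toLp 2 (update z x t) + ψ) (EuclideanSpace.single x (1 : ℝ)))) * (s - t) := by
  have hM := mulVec_update_apply M z x x s t
  have hM' : ((M *ᵥ update z x s) x - (M *ᵥ update z x t) x) * (s - t) = M x x * (s - t) ^ 2 := by rw [hM]; ring
  have hU := hUfloor x (WithLp.toLp 2 (update z x t) + ψ) (s - t)
  rw [← toLp_update z x s t ψ] at hU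
  nlinarith [hM', hU]

/-- **The diagonal ceiling** `Cw = mM + κd`. [folklore] -/
theorem tilted_ceiling (hUceil : ∀ (x : ι) (φ : EuclideanSpace ℝ ι) (r : ℝ),
      |U' (φ + r • EuclideanSpace.single x (1 : ℝ)) (EuclideanSpace.single x (1 : ℝ)) - U' φ (EuclideanSpace.single x (1 : ℝ))| ≤ κd * |r|)
    (hMdiag : ∀ x, |M x x| ≤ mM) (ψ : EuclideanSpace ℝ ι) (x : ι) (z : ι → ℝ) (s t : ℝ) :
    |((M *ᵥ update z x s) x + U' (WithLp.toLp 2 (update z x s) + ψ) (EuclideanSpace.single x (1 : ℝ))) -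
        ((M *ᵥ update z x t) x + U' (WithLp.toLp 2 (update z x t) + ψ) (EuclideanSpace.single x (1 : ℝ)))| ≤ (mM + κd) * |s - t| := by
  have hM := mulVec_update_apply M z x x s t
  have hU := hUceil x (WithLp.toLp 2 (update z x t) + ψ) (s - t)
  rw [← toLp_update z x s t ψ] at hU
  have e : ((M *ᵥ update z x s) x + U' (WithLp.toLp 2 (update z x s) + ψ) (EuclideanSpace.single x (1 : ℝ))) -
      ((M *ᵥ update z x t) x + U' (WithLp.toLp 2 (update z x t) + ψ) (EuclideanSpace.single x (1 : ℝ))) =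
      M x x * (s - t) + (U' (WithLp.toLp 2 (update z x s) + ψ) (EuclideanSpace.single x (1 : ℝ)) -
        U' (WithLp.toLp 2 (update z x t) + ψ) (EuclideanSpace.single x (1 : ℝ))) := by linarith
  rw [e]
  calc |M x x * (s - t) + (U' (WithLp.toLp 2 (update z x s) + ψ) (EuclideanSpace.single x (1 : ℝ)) -
        U' (WithLp.toLp 2 (update z x t) + ψ) (EuclideanSpace.single x (1 : ℝ)))|
      ≤ |M x x * (s - t)| + |U' (WithLp.toLp 2 (update z x s) + ψ) (EuclideanSpace.single x (1 : ℝ)) -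
        U' (WithLp.toLp 2 (update z x t) + ψ) (EuclideanSpace.single x (1 : ℝ))| := abs_add_le _ _
    _ ≤ mM * |s - t| + κd * |s - t| := by
        rw [abs_mul]; exact add_le_add (mul_le_mul_of_nonneg_right (hMdiag x) (abs_nonneg _)) hU
    _ = (mM + κd) * |s - t| := by ring

/-- **The cross letters** `J_{xw} = |M_{xw}| + H_{xw}` (`w ≠ x`). [folklore] -/
theorem tilted_cross (hUcross : ∀ (x w : ι) (φ : EuclideanSpace ℝ ι) (r : ℝ),
      |U' (φ + r • EuclideanSpace.single w (1 : ℝ)) (EuclideanSpace.single x (1 : ℝ)) - U' φ (EuclideanSpace.single x (1 : ℝ))| ≤ H x w * |r|)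
    (ψ : EuclideanSpace ℝ ι) (x w : ι) (z : ι → ℝ) (s t : ℝ) :
    |((M *ᵥ update z w s) x + U' (WithLp.toLp 2 (update z w s) + ψ) (EuclideanSpace.single x (1 : ℝ))) -
        ((M *ᵥ update z w t) x + U' (WithLp.toLp 2 (update z w t) + ψ) (EuclideanSpace.single x (1 : ℝ)))| ≤ (|M x w| + H x w) * |s - t| := by
  have hM := mulVec_update_apply M z w x s t
  have hU := hUcross x w (WithLp.toLp 2 (update z w t) + ψ) (s - t)
  rw [← toLp_update z w s t ψ] at hU
  have e : ((M *ᵥ update z w s) x + U' (WithLp.toLp 2 (update z w s) + ψ) (EuclideanSpace.single x (1 : ℝ))) -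
      ((M *ᵥ update z w t) x + U' (WithLp.toLp 2 (update z w t) + ψ) (EuclideanSpace.single x (1 : ℝ))) =
      M x w * (s - t) + (U' (WithLp.toLp 2 (update z w s) + ψ) (EuclideanSpace.single x (1 : ℝ)) -
        U' (WithLp.toLp 2 (update z w t) + ψ) (EuclideanSpace.single x (1 : ℝ))) := by linarith
  rw [e]
  calc |M x w * (s - t) + (U' (WithLp.toLp 2 (update z w s) + ψ) (EuclideanSpace.single x (1 : ℝ)) -
        U' (WithLp.toLp 2 (update z w t) + ψ) (EuclideanSpace.single x (1 : ℝ)))|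
      ≤ |M x w * (s - t)| + |U' (WithLp.toLp 2 (update z w s) + ψ) (EuclideanSpace.single x (1 : ℝ)) -
        U' (WithLp.toLp 2 (update z w t) + ψ) (EuclideanSpace.single x (1 : ℝ))| := abs_add_le _ _
    _ ≤ |M x w| * |s - t| + H x w * |s - t| := by rw [abs_mul]; exact add_le_add le_rfl hU
    _ = (|M x w| + H x w) * |s - t| := by ring

omit [DecidableEq ι] in
/-- **`V` is continuous** (`U ∈ C¹`, the quadratic form is a polynomial). [folklore] -/
theorem tilted_continuous (hUd : ∀ φ, HasFDerivAt U (U' φ) φ) (ψ : EuclideanSpace ℝ ι) :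
    Continuous fun z : ι → ℝ => 1 / 2 * (z ⬝ᵥ (M *ᵥ z)) + U (WithLp.toLp 2 z + ψ) := by
  have hUc : Continuous U := continuous_iff_continuousAt.2 fun φ => (hUd φ).continuousAt
  have hq : Continuous fun z : ι → ℝ => z ⬝ᵥ (M *ᵥ z) := by
    have e : (fun z : ι → ℝ => z ⬝ᵥ (M *ᵥ z)) = fun z => ∑ i, z i * ∑ j, M i j * z j := by
      funext z; simp only [dotProduct, mulVec]
    rw [e]
    exact continuous_finsetSum _ fun i _ => (continuous_apply i).mul (continuous_finsetSum _ fun j _ =>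
      continuous_const.mul (continuous_apply j))
  have hl : Continuous fun z : ι → ℝ => WithLp.toLp 2 z + ψ := by fun_prop
  exact (continuous_const.mul hq).add (hUc.comp hl)

omit [Fintype ι] in
/-- **The gradient components are in the class**: `F_x(z) = U′(toLp z + ψ)(e_x)` has coordinate-Lipschitz vector `Hd_x`
(`κd` at `x`, `H_{xw}` at `w ≠ x`). [folklore] -/
theorem gradient_obs_lipVec (hUceil : ∀ (x : ι) (φ : EuclideanSpace ℝ ι) (r : ℝ),
      |U' (φ + r • EuclideanSpace.single x (1 : ℝ)) (EuclideanSpace.single x (1 : ℝ)) - U' φ (EuclideanSpace.single x (1 : ℝ))| ≤ κd * |r|)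
    (hUcross : ∀ (x w : ι) (φ : EuclideanSpace ℝ ι) (r : ℝ),
      |U' (φ + r • EuclideanSpace.single w (1 : ℝ)) (EuclideanSpace.single x (1 : ℝ)) - U' φ (EuclideanSpace.single x (1 : ℝ))| ≤ H x w * |r|)
    (ψ : EuclideanSpace ℝ ι) (x w : ι) (z : ι → ℝ) (s t : ℝ) :
    |U' (WithLp.toLp 2 (update z w s) + ψ) (EuclideanSpace.single x (1 : ℝ)) - U' (WithLp.toLp 2 (update z w t) + ψ) (EuclideanSpace.single x (1 : ℝ))|
      ≤ (if w = x then κd else H x w) * |s - t| := by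
  rw [toLp_update z w s t ψ]
  split_ifs with h
  · rw [h]; exact hUceil x _ (s - t)
  · exact hUcross x w _ (s - t)

/-! ## §3. The covariance kernel letter -/

/-- **THE COVARIANCE KERNEL LETTER OF THE TILTED GAUSSIAN, UNIFORM IN THE BACKGROUND AND THE VOLUME**: with `V(z) = ½z·Mz +
U(toLp z + ψ)`, first-order kernel letters `lam, κd, H` of the input, the precision letters `|M_{xx}| ≤ mM`, `cmin ≤ M_{xx} − lam`
(`cmin > 0`), Dobrushin's matrix `J_{xw} = |M_{xw}| + H_{xw}` (`w ≠ x`, `0` on the diagonal) with rows `Σ_wJ_{xw}∕c_x ≤ γ < 1` and columns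
`Σ_xJ_{xw}∕c_x ≤ γ′ < 1`, the row∕column letters `Σ_wHd_{xw} ≤ κR`, `Σ_xHd_{xw} ≤ κC` of the first-order majorant, and the moment letters,
the gradient components `F_x = U′(toLp · + ψ)(e_x)` satisfy
`Σ_y |∫F_xF_y dν − ∫F_x dν·∫F_y dν| ≤ κR·κC·(1−γ)⁻¹·(1−γ′)⁻¹∕cmin`, `ν = e^{−V}dz∕∫e^{−V}`. [folklore: Föllmer 1982] -/
theorem tilted_cov_kernel_rowsum_le (hMsym : M.IsSymm) (hUd : ∀ φ, HasFDerivAt U (U' φ) φ)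
    (hP : ∀ x F ω, P x F ω = (∫ s, F (update ω x s) * exp (-(1 / 2 * (update ω x s ⬝ᵥ (M *ᵥ update ω x s)) + U (WithLp.toLp 2 (update ω x s) + ψ)))) /
      ∫ s, exp (-(1 / 2 * (update ω x s ⬝ᵥ (M *ᵥ update ω x s)) + U (WithLp.toLp 2 (update ω x s) + ψ))))
    (hUfloor : ∀ (x : ι) (φ : EuclideanSpace ℝ ι) (r : ℝ),
      -lam * r ^ 2 ≤ (U' (φ + r • EuclideanSpace.single x (1 : ℝ)) (EuclideanSpace.single x (1 : ℝ)) - U' φ (EuclideanSpace.single x (1 : ℝ))) * r)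
    (hUceil : ∀ (x : ι) (φ : EuclideanSpace ℝ ι) (r : ℝ),
      |U' (φ + r • EuclideanSpace.single x (1 : ℝ)) (EuclideanSpace.single x (1 : ℝ)) - U' φ (EuclideanSpace.single x (1 : ℝ))| ≤ κd * |r|)
    (hUcross : ∀ (x w : ι) (φ : EuclideanSpace ℝ ι) (r : ℝ),
      |U' (φ + r • EuclideanSpace.single w (1 : ℝ)) (EuclideanSpace.single x (1 : ℝ)) - U' φ (EuclideanSpace.single x (1 : ℝ))| ≤ H x w * |r|)
    (hH : ∀ x w, 0 ≤ H x w) (hκd : 0 ≤ κd) (hMdiag : ∀ x, |M x x| ≤ mM) (hcmin : 0 < cmin) (hcm : ∀ x, cmin ≤ M x x - lam)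
    (hrow : ∀ x, ∑ w, (if w = x then 0 else |M x w| + H x w) / (M x x - lam) ≤ γ) (hγ0 : 0 ≤ γ) (hγ1 : γ < 1)
    (hcol : ∀ w, ∑ x, (if w = x then 0 else |M x w| + H x w) / (M x x - lam) ≤ γ') (hγ'1 : γ' < 1)
    (hκR : ∀ x, ∑ w, (if w = x then κd else H x w) ≤ κR) (hκC : ∀ w, ∑ x, (if w = x then κd else H x w) ≤ κC)
    (hV0 : Integrable (fun z : ι → ℝ => exp (-(1 / 2 * (z ⬝ᵥ (M *ᵥ z)) + U (WithLp.toLp 2 z + ψ)))))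
    (hV2 : ∀ w, Integrable (fun z : ι → ℝ => z w ^ 2 * exp (-(1 / 2 * (z ⬝ᵥ (M *ᵥ z)) + U (WithLp.toLp 2 z + ψ))))) (x : ι) :
    ∑ y, |∫ z, U' (WithLp.toLp 2 z + ψ) (EuclideanSpace.single x (1 : ℝ)) * U' (WithLp.toLp 2 z + ψ) (EuclideanSpace.single y (1 : ℝ))
          ∂((volume : Measure (ι → ℝ)).tilted fun z => -(1 / 2 * (z ⬝ᵥ (M *ᵥ z)) + U (WithLp.toLp 2 z + ψ))) -
        (∫ z, U' (WithLp.toLp 2 z + ψ) (EuclideanSpace.single x (1 : ℝ))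
          ∂((volume : Measure (ι → ℝ)).tilted fun z => -(1 / 2 * (z ⬝ᵥ (M *ᵥ z)) + U (WithLp.toLp 2 z + ψ)))) *
        (∫ z, U' (WithLp.toLp 2 z + ψ) (EuclideanSpace.single y (1 : ℝ))
          ∂((volume : Measure (ι → ℝ)).tilted fun z => -(1 / 2 * (z ⬝ᵥ (M *ᵥ z)) + U (WithLp.toLp 2 z + ψ))))| ≤
      κR * κC * (1 - γ)⁻¹ * (1 - γ')⁻¹ / cmin := by
  -- Dobrushin's matrix and its Neumann series
  set Cm : Matrix ι ι ℝ := Matrix.of fun x w => (if w = x then 0 else |M x w| + H x w) / (M x x - lam) with hCm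
  have hc : ∀ x, 0 < M x x - lam := fun x => hcmin.trans_le (hcm x)
  have hJ : ∀ x w, 0 ≤ (if w = x then (0 : ℝ) else |M x w| + H x w) := fun x w => by
    split_ifs
    · exact le_rfl
    · exact add_nonneg (abs_nonneg _) (hH x w)
  have hCmnn : ∀ x w, 0 ≤ Cm x w := fun x w => by rw [hCm, Matrix.of_apply]; exact div_nonneg (hJ x w) (hc x).le
  have hCmrow : ∀ x, ∑ w, Cm x w ≤ γ := fun x => by simp only [hCm, Matrix.of_apply]; exact hrow x
  have hCmcol : ∀ w, ∑ x, Cm x w ≤ γ' := fun w => by simp only [hCm, Matrix.of_apply]; exact hcol w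
  have hD : ∀ x y, 0 ≤ ∑' n : ℕ, (Cm ^ n) x y := neumann_nonneg hCmnn
  have hDC : ∀ x y, (if x = y then (1 : ℝ) else 0) + ∑ w, (∑' n : ℕ, (Cm ^ n) x w) *
      ((if y = w then 0 else |M w y| + H w y) / (M w w - lam)) ≤ ∑' n : ℕ, (Cm ^ n) x y := by
    intro x y
    have h := neumann_dominates hCmnn hCmrow hγ0 hγ1 x y
    simp only [hCm, Matrix.of_apply] at h ⊢
    exact h
  have hDr : ∀ z, ∑ w, ∑' n : ℕ, (Cm ^ n) z w ≤ (1 - γ)⁻¹ := neumann_rowsum_le hCmnn hCmrow hγ0 hγ1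
  have hDc : ∀ w, ∑ z, ∑' n : ℕ, (Cm ^ n) z w ≤ (1 - γ')⁻¹ := neumann_colsum_le hCmnn hCmrow hγ0 hγ1 hCmcol hγ'1
  -- (447) with `V`, `V₁`, `c`, `J`, the family `F_y` and its vectors `Hd_y`
  have h := cov_rowsum_le_gibbs (D := fun x y => ∑' n : ℕ, (Cm ^ n) x y) (c := fun x => M x x - lam) (Cw := mM + κd)
    (J := fun x w => if w = x then 0 else |M x w| + H x w) (γ := γ)
    (V := fun z => 1 / 2 * (z ⬝ᵥ (M *ᵥ z)) + U (WithLp.toLp 2 z + ψ))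
    (V₁ := fun x z => (M *ᵥ z) x + U' (WithLp.toLp 2 z + ψ) (EuclideanSpace.single x (1 : ℝ)))
    (F := fun z => U' (WithLp.toLp 2 z + ψ) (EuclideanSpace.single x (1 : ℝ)))
    (Gf := fun y z => U' (WithLp.toLp 2 z + ψ) (EuclideanSpace.single y (1 : ℝ)))
    (a := fun w => if w = x then κd else H x w) (bf := fun y w => if w = y then κd else H y w)
    Finset.univ hP (fun x z => tilted_line_hasDerivAt hMsym hUd ψ x z) (fun x z s t => tilted_floor hUfloor ψ x z s t) hc
    (fun x z s t => tilted_ceiling hUceil hMdiag ψ x z s t)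
    (fun x w hw z s t => by rw [if_neg hw]; exact tilted_cross hUcross ψ x w z s t)
    (tilted_continuous hUd ψ) hV0 hV2 hJ (fun x => by simp) hrow hγ0 hγ1 hD hDC hDr hDc hcmin hcm
    (fun w z s t => gradient_obs_lipVec hUceil hUcross ψ x w z s t) (fun y w z s t => gradient_obs_lipVec hUceil hUcross ψ y w z s t)
    (fun w => hκC w)
  refine h.trans ?_
  have hκR' : ∑ w, (if w = x then κd else H x w) ≤ κR := hκR x
  have hκC0 : 0 ≤ κC := by
    rcases isEmpty_or_nonempty ι with hι | ⟨⟨w⟩⟩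
    · exact (hι.false x).elim
    · exact le_trans (Finset.sum_nonneg fun y _ => by split_ifs; exacts [hκd, hH y w]) (hκC w)
  have hpos : 0 ≤ κC * (1 - γ)⁻¹ * (1 - γ')⁻¹ / cmin := by
    have h1 : 0 < 1 - γ := by linarith
    have hγ'0 : 0 ≤ γ' := by
      rcases isEmpty_or_nonempty ι with hι | ⟨⟨w⟩⟩
      · exact (hι.false x).elim
      · exact (Finset.sum_nonneg fun z _ => hCmnn z w).trans (hCmcol w)
    have h2 : 0 < 1 - γ' := by linarith
    positivity
  calc (∑ w, (if w = x then κd else H x w)) * κC * (1 - γ)⁻¹ * (1 - γ')⁻¹ / cmin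
      = (∑ w, (if w = x then κd else H x w)) * (κC * (1 - γ)⁻¹ * (1 - γ')⁻¹ / cmin) := by ring
    _ ≤ κR * (κC * (1 - γ)⁻¹ * (1 - γ')⁻¹ / cmin) := mul_le_mul_of_nonneg_right hκR' hpos
    _ = κR * κC * (1 - γ)⁻¹ * (1 - γ')⁻¹ / cmin := by ring

end Summit.QuantumFields.BalabanUV.T4Continuum.NE7b.SupTiltedCovarianceKernelLetter

end
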